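import Summits.QuantumFields.GaugeBoot.PlanarClassIdentificationRateSharp
import HarnessLib

/-!
# The `1/N²` law for Kazakov–Zheng's printed (class-indexed) format — modulo Shen–Zhu–Zhu (gauge-boot, large-`N` supplement 20)

HONEST FRAMING (cell `pub-gaugeboot`, page 1 of every file): the venture produces certified bounds
on lattice expectations at stated coupling, gauge group, dimension and torus size; NOT a mass gap,
NOT a continuum limit, NOT a string tension; NOT large `N` unless marked CONDITIONAL; NOT
Yang–Mills-summit-bearing (barriers `FixedCouplingUltralocality`, `PerturbativeInvisibility`).
CONDITIONAL on the tree's named fact `shenZhuZhu_largeN_variance` (SZZ CMP 400 (2023) Cor. 1.5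
(1.12)); this file certifies no number and no planar certificate of the cell exists in the tree.

## Content

Kazakov–Zheng index the relaxation variables `Q_{ij}` of their planar SDP by PAIRS OF SYMMETRY CLASSES of
loops; read at finite `N`, such a variable silently identifies `Q(A', B)` with `Q(A, B)` for SEPARATELY
translated copies `A' = p·A·p⁻¹` — an identification row of the certificate that a finite-`N` state
violates by a covariance (supplement 7), of size `O(1/N²)` at strong 't Hooft coupling (supplement 18,
`abs_loopQ_conjPath_sub_loopQ_le_of_szz_sharp`).  Hence:

* ★★★ `PlanarCertificate.obj_le_bound_add_div_sq_of_szz_classRows` — GIVEN SZZ (1.12), `d ≥ 2`,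
  `|βt| < 1/(16(d−1))`: a valid planar certificate whose identification rows are separate-translation
  identifications `lin_e(W, Q) = Q(p_e·A_e·p_e⁻¹, B_e) − Q(A_e, B_e)` obeys, for EVERY `N ≥ 1` and every
  thermodynamic limit point `μ_N` of the `SU(N)` torus Wilson states at tree coupling `N·βt`,
  `obj(W_{μ_N}) ≤ bound + (K' + K_class)/N²` (`K' = szzRateConst'` of supplement 19, explicit
  `K_class = szzClassRateConst` from the walks realising the identified loops);
* ★★★ `PlanarCertificate.obj_le_bound_add_div_sq_of_szz_classRows_of_cyclicallyReduced` — the same with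
  DECIDABLE side conditions only: all word data (relaxation loops, marked words, identified loops)
  cyclically reduced and closed at `x`; constant `szzRateConstWords + szzClassRateConstWords` from the
  word lengths alone.

So THE `1/N²` LAW HOLDS FOR THE PRINTED FORMAT TOO (supplement 12 had `O(1/N)` for it).  Whether `1/N²`
is sharp, and anything at `|βt| ≥ 1/(16(d−1))`, is not claimed.  [folklore] bookkeeping on top of SZZ.
-/

noncomputable section

open MeasureTheory ProbabilityTheory
open scoped BigOperators
open Literature.Probability.LatticeModels (Site zdGraph)
open Literature.MathematicalPhysics.QuantumLattice
open Literature.MathematicalPhysics.QuantumFieldTheory (szzThresholdSU shenZhuZhu_largeN_variance IsNonBacktrackingLoop)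

namespace Summit.QuantumFields.GaugeBoot

variable {d N : ℕ}

/-! ## The `1/N²` law for the printed (class-indexed) format -/

namespace PlanarCertificate

variable (P : PlanarCertificate d)

/-- **The class-identification part of the `1/N²` constant**: `Σ_e |z_e| (√K_{A_e'} + √K_{A_e}) √K_{B_e}`
from the walks realising the identified loops. [folklore] -/
def szzClassRateConst (x : Site d) (pE : Fin P.nE → Word d)
    (γA : (e : Fin P.nE) → (zdGraph d).Walk x x)
    (γA' : (e : Fin P.nE) → (zdGraph d).Walk (Word.endpointZd x (pE e)) (Word.endpointZd x (pE e)))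
    (γB : (e : Fin P.nE) → (zdGraph d).Walk x x) : ℝ :=
  ∑ e, |P.linMult e| * ((Real.sqrt (4 * (((γA' e).length : ℝ) * (((γA' e).length : ℝ) - 3)) / szzPlanarSlope d P.βt) +
      Real.sqrt (4 * (((γA e).length : ℝ) * (((γA e).length : ℝ) - 3)) / szzPlanarSlope d P.βt)) *
    Real.sqrt (4 * (((γB e).length : ℝ) * (((γB e).length : ℝ) - 3)) / szzPlanarSlope d P.βt))

/-- ★★★ **THE `1/N²` LAW FOR KAZAKOV–ZHENG'S PRINTED (CLASS-INDEXED) FORMAT (given SZZ (1.12)).**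
`d ≥ 2`, `|βt| < 1/(16(d−1))`; `P` a valid planar certificate at `βt` whose identification rows are the
separate-translation identifications `lin_e(W, Q) = Q(p_e·A_e·p_e⁻¹, B_e) − Q(A_e, B_e)` (`A_e, B_e` closed
at `x`); relaxation loops, marked words and the identified loops `A_e` (at `x` and at `endpoint x p_e`),
`B_e` realised by non-backtracking closed walks (plaquette words need no data, supplement 19); `μ_N` (`N ≥ 1`) any
thermodynamic limit point of the `SU(N)` torus Wilson states at tree coupling `N·βt`.  Then
`obj(W_{μ_N}) ≤ bound + (K' + K_class)/N²`, `K' = szzRateConst'`, `K_class = szzClassRateConst`.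
[cite: ShenZhuZhuCMP2023, Corollary 1.5] -/
theorem obj_le_bound_add_div_sq_of_szz_classRows (hP : P.IsValid) (hfact : ∀ N, shenZhuZhu_largeN_variance d N)
    (hd : 2 ≤ d) (hβ : |P.βt| < szzThresholdSU d) (hN : 1 ≤ N)
    {μ : Measure (LGConfig d (Matrix.specialUnitaryGroup (Fin N) ℂ))}
    (hμ : μ ∈ infiniteVolumeLimitPoints (d := d) (fundamentalRep (Fin N)) ((N : ℝ) * P.βt)) (x : Site d)
    (hrow : ∀ r, Word.endpointZd x (P.rowWord r) = x) (hgram : ∀ j i, Word.endpointZd x (P.gramWord j i) = x)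
    -- the identification rows are separate-translation identifications
    (pE AE BE : Fin P.nE → Word d) (hAE : ∀ e, Word.endpointZd x (AE e) = x)
    (hlinE : ∀ e (W : Word d → ℝ) (Q : Word d → Word d → ℝ), P.lin e W Q = Q (pE e ++ AE e ++ (pE e).reverse) (BE e) - Q (AE e) (BE e))
    -- walks
    (γS : (A : Fin P.nI) → (zdGraph d).Walk x x) (hγS : ∀ A, IsNonBacktrackingLoop (γS A))
    (hholS : ∀ A (U : LGConfig d (Matrix.specialUnitaryGroup (Fin N) ℂ)), walkHolonomy U (γS A) = wordHolonomyZd U x (P.shorLoop A))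
    (γR : (r : Fin P.nR) → (zdGraph d).Walk x x) (hγR : ∀ r, IsNonBacktrackingLoop (γR r))
    (hholR : ∀ r (U : LGConfig d (Matrix.specialUnitaryGroup (Fin N) ℂ)), walkHolonomy U (γR r) = wordHolonomyZd U x (P.rowWord r))
    (γA : (e : Fin P.nE) → (zdGraph d).Walk x x) (hγA : ∀ e, IsNonBacktrackingLoop (γA e))
    (hholA : ∀ e (U : LGConfig d (Matrix.specialUnitaryGroup (Fin N) ℂ)), walkHolonomy U (γA e) = wordHolonomyZd U x (AE e))
    (γA' : (e : Fin P.nE) → (zdGraph d).Walk (Word.endpointZd x (pE e)) (Word.endpointZd x (pE e)))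
    (hγA' : ∀ e, IsNonBacktrackingLoop (γA' e))
    (hholA' : ∀ e (U : LGConfig d (Matrix.specialUnitaryGroup (Fin N) ℂ)),
      walkHolonomy U (γA' e) = wordHolonomyZd U (Word.endpointZd x (pE e)) (AE e))
    (γB : (e : Fin P.nE) → (zdGraph d).Walk x x) (hγB : ∀ e, IsNonBacktrackingLoop (γB e))
    (hholB : ∀ e (U : LGConfig d (Matrix.specialUnitaryGroup (Fin N) ℂ)), walkHolonomy U (γB e) = wordHolonomyZd U x (BE e)) :
    P.obj (loopW (fundamentalRep (Fin N)) μ x) ≤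
      P.bound + (P.szzRateConst' x γS γR + P.szzClassRateConst x pE γA γA' γB) / (N : ℝ) ^ 2 := by
  haveI : SecondCountableTopology (Matrix (Fin N) (Fin N) ℂ) :=
    inferInstanceAs (SecondCountableTopology (Fin N → Fin N → ℂ))
  haveI : SecondCountableTopology (Matrix.specialUnitaryGroup (Fin N) ℂ) :=
    Topology.IsEmbedding.subtypeVal.secondCountableTopology
  haveI : IsProbabilityMeasure μ := by obtain ⟨L, -, hL⟩ := hμ; exact hL.1
  have hρ := continuous_fundamentalRep (Fin N)
  have hβ' : (N : ℝ) * P.βt / N = P.βt := natCast_mul_div_natCast hN P.βt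
  -- the transfer with defective identification rows
  have h := P.obj_loopW_le' (fundamentalRep (Fin N)) hP hρ μ x hgram (P.rowDefectSuN μ x)
    (fun e => (Real.sqrt (4 * (((γA' e).length : ℝ) * (((γA' e).length : ℝ) - 3)) / szzPlanarSlope d P.βt) +
        Real.sqrt (4 * (((γA e).length : ℝ) * (((γA e).length : ℝ) - 3)) / szzPlanarSlope d P.βt)) *
      Real.sqrt (4 * (((γB e).length : ℝ) * (((γB e).length : ℝ) - 3)) / szzPlanarSlope d P.βt) / (N : ℝ) ^ 2)
    (fun r => by
      have h := abs_planarRow_loopData_suN_le_of_mem_infiniteVolumeLimitPoints hμ x (P.rowAxis r) (P.rowWord r) (hrow r)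
      rw [hβ'] at h
      exact h)
    (fun e => by
      rw [hlinE]
      exact abs_loopQ_conjPath_sub_loopQ_le_of_szz_sharp hfact hd hβ hN hμ x (pE e) (AE e) (BE e) (hAE e)
        (γA e) (hγA e) (hholA e) (γA' e) (hγA' e) (hholA' e) (γB e) (hγB e) (hholB e))
  refine h.trans ?_
  have H12 : (∑ r, |P.rowMult r| * P.rowDefectSuN μ x r) + ∑ s, P.shorDefect (fundamentalRep (Fin N)) μ x s ≤
      P.szzRateConst' x γS γR / (N : ℝ) ^ 2 := by
    rw [szzRateConst', add_div, Finset.sum_div, Finset.sum_div]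
    gcongr with r _ s _
    · rw [mul_div_assoc]
      gcongr
      exact P.rowDefectSuN_le_of_szz' hfact hd hβ hN hμ x γR hγR hholR r
    · exact P.shorDefect_le_of_szz hfact hd hβ hN hμ x γS hγS hholS s
  have H3 : (∑ e, |P.linMult e| * ((Real.sqrt (4 * (((γA' e).length : ℝ) * (((γA' e).length : ℝ) - 3)) / szzPlanarSlope d P.βt) +
        Real.sqrt (4 * (((γA e).length : ℝ) * (((γA e).length : ℝ) - 3)) / szzPlanarSlope d P.βt)) *
      Real.sqrt (4 * (((γB e).length : ℝ) * (((γB e).length : ℝ) - 3)) / szzPlanarSlope d P.βt) / (N : ℝ) ^ 2)) =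
      P.szzClassRateConst x pE γA γA' γB / (N : ℝ) ^ 2 := by
    rw [szzClassRateConst, Finset.sum_div]
    exact Finset.sum_congr rfl fun e _ => (mul_div_assoc _ _ _).symm
  have H4 : (P.szzRateConst' x γS γR + P.szzClassRateConst x pE γA γA' γB) / (N : ℝ) ^ 2 =
      P.szzRateConst' x γS γR / (N : ℝ) ^ 2 + P.szzClassRateConst x pE γA γA' γB / (N : ℝ) ^ 2 := add_div _ _ _
  linarith [H12, H3, H4]


/-- **The class-identification constant from WORD DATA alone**: `Σ_e |z_e| · 2 √K_{A_e} √K_{B_e}`,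
`K_C = 4 |C|(|C|−3)/c₀`. [folklore] -/
def szzClassRateConstWords (AE BE : Fin P.nE → Word d) : ℝ :=
  ∑ e, |P.linMult e| * (2 * Real.sqrt (4 * (((AE e).length : ℝ) * (((AE e).length : ℝ) - 3)) / szzPlanarSlope d P.βt) *
    Real.sqrt (4 * (((BE e).length : ℝ) * (((BE e).length : ℝ) - 3)) / szzPlanarSlope d P.βt))

/-- With the walks of the words themselves, `szzClassRateConst` is `szzClassRateConstWords`. [folklore] -/
theorem szzClassRateConst_toLoopZd (x : Site d) (pE AE BE : Fin P.nE → Word d) (hAE : ∀ e, Word.endpointZd x (AE e) = x)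
    (hBE : ∀ e, Word.endpointZd x (BE e) = x) :
    P.szzClassRateConst x pE (fun e => Word.toLoopZd x (AE e) (hAE e))
        (fun e => Word.toLoopZd (Word.endpointZd x (pE e)) (AE e) (Word.endpointZd_eq_self_of_closed (hAE e) _))
        (fun e => Word.toLoopZd x (BE e) (hBE e)) =
      P.szzClassRateConstWords AE BE := by
  simp only [szzClassRateConst, szzClassRateConstWords, Word.length_toLoopZd]
  exact Finset.sum_congr rfl fun e _ => by ring

/-- ★★★ **THE `1/N²` LAW FOR THE PRINTED FORMAT WITH DECIDABLE SIDE CONDITIONS ONLY** (given SZZ (1.12),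
`d ≥ 2`, `|βt| < 1/(16(d−1))`): `P` valid at `βt`, identification rows the separate-translation
identifications of CYCLICALLY REDUCED closed words `A_e, B_e` through paths `p_e`; relaxation loops and
marked words cyclically reduced and closed at `x`, Gram words closed at `x`; `μ_N` (`N ≥ 1`) any
thermodynamic limit point of the `SU(N)` torus states at tree coupling `N·βt`.  Then
`obj(W_{μ_N}) ≤ bound + (K_w + K_class,w)/N²` with constants from the word data alone.
[cite: ShenZhuZhuCMP2023, Corollary 1.5] -/
theorem obj_le_bound_add_div_sq_of_szz_classRows_of_cyclicallyReduced (hP : P.IsValid)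
    (hfact : ∀ N, shenZhuZhu_largeN_variance d N) (hd : 2 ≤ d) (hβ : |P.βt| < szzThresholdSU d) (hN : 1 ≤ N)
    {μ : Measure (LGConfig d (Matrix.specialUnitaryGroup (Fin N) ℂ))}
    (hμ : μ ∈ infiniteVolumeLimitPoints (d := d) (fundamentalRep (Fin N)) ((N : ℝ) * P.βt)) (x : Site d)
    (hrow : ∀ r, Word.endpointZd x (P.rowWord r) = x) (hgram : ∀ j i, Word.endpointZd x (P.gramWord j i) = x)
    (hS : ∀ A, Word.endpointZd x (P.shorLoop A) = x)
    (hredR : ∀ r, (P.rowWord r).CyclicallyReduced) (hredS : ∀ A, (P.shorLoop A).CyclicallyReduced)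
    (pE AE BE : Fin P.nE → Word d) (hAE : ∀ e, Word.endpointZd x (AE e) = x) (hBE : ∀ e, Word.endpointZd x (BE e) = x)
    (hredA : ∀ e, (AE e).CyclicallyReduced) (hredB : ∀ e, (BE e).CyclicallyReduced)
    (hlinE : ∀ e (W : Word d → ℝ) (Q : Word d → Word d → ℝ), P.lin e W Q = Q (pE e ++ AE e ++ (pE e).reverse) (BE e) - Q (AE e) (BE e)) :
    P.obj (loopW (fundamentalRep (Fin N)) μ x) ≤
      P.bound + (P.szzRateConstWords + P.szzClassRateConstWords AE BE) / (N : ℝ) ^ 2 := by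
  rw [← P.szzRateConst'_toLoopZd x hS hrow, ← P.szzClassRateConst_toLoopZd x pE AE BE hAE hBE]
  exact P.obj_le_bound_add_div_sq_of_szz_classRows hP hfact hd hβ hN hμ x hrow hgram pE AE BE hAE hlinE
    (fun A => Word.toLoopZd x (P.shorLoop A) (hS A)) (fun A => isNonBacktrackingLoop_toLoopZd x _ (hS A) (hredS A))
    (fun A U => walkHolonomy_toLoopZd U x _ (hS A))
    (fun r => Word.toLoopZd x (P.rowWord r) (hrow r)) (fun r => isNonBacktrackingLoop_toLoopZd x _ (hrow r) (hredR r))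
    (fun r U => walkHolonomy_toLoopZd U x _ (hrow r))
    (fun e => Word.toLoopZd x (AE e) (hAE e)) (fun e => isNonBacktrackingLoop_toLoopZd x _ (hAE e) (hredA e))
    (fun e U => walkHolonomy_toLoopZd U x _ (hAE e))
    (fun e => Word.toLoopZd (Word.endpointZd x (pE e)) (AE e) (Word.endpointZd_eq_self_of_closed (hAE e) _))
    (fun e => isNonBacktrackingLoop_toLoopZd _ _ _ (hredA e)) (fun e U => walkHolonomy_toLoopZd U _ _ _)
    (fun e => Word.toLoopZd x (BE e) (hBE e)) (fun e => isNonBacktrackingLoop_toLoopZd x _ (hBE e) (hredB e))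
    (fun e U => walkHolonomy_toLoopZd U x _ (hBE e))

end PlanarCertificate

end Summit.QuantumFields.GaugeBoot

end
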